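import Literature.Computability.Complexity.BipartiteLabelCover
import HarnessLib

/-!
# Label cover instances as constraint tables: the list form of products, blow-ups and the rendering

Topic `Computability/Complexity`, namespace `Literature.Computability.Complexity.BLC`.  The machine level
of the tree's reduction to gap label cover (`GapE3CNFToLabelCover.lean`) computes lists, not `Fin`-indexed
structures; this file renders the operations of `BipartiteLabelCover.lean` as operations on the
**constraint table** of an instance — the list, in edge order, of the triples
`(src e, dst e, [proj e 0, …, proj e (WB - 1)])` of natural numbers — and proves the renderings correct:

* `srcN`, `dstN`, `projN` — total `ℕ`-valued accessors; `conList I` — the constraint table;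
  `toLC_constraints` — `I.toLC` is its table with Alice's indices shifted by `nB`;
* `prodL` with `conList_prod` — the table of `I ⊗ J` is obtained from the two tables by the mixed-radix
  formulas `src = src₂ + nB₂ src₁`, `dst = dst₂ + nA₂ dst₁`, `proj = [a₂ + WA₂ a₁ | a₁ ← proj₁, a₂ ← proj₂]`
  (rows in the order edge₁-major);
* `blowAL` with `conList_blowA` — the table of the Alice-side blow-up (`dst ↦ j + c dst`, `j < c`, copies
  consecutive);
* `conList_unit`, and `npowL` with `conList_npow` — the table of `I^{⊗k}` by iterating `prodL`.

All statements are equalities of lists; the only analysis is `List.range (a b)` in blocks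
(`map_range_mul`).

## References

* S. Arora, B. Barak, *Computational Complexity: A Modern Approach*, CUP 2009, §22.3.1 (the instance
  `φ^{*t}`), §1.3 (representation of instances as lists).
-/

namespace Literature.Computability.Complexity

open Finset

/-! ### Two list lemmas -/

/-- `finRange` maps agree with `range` maps of a total extension. [folklore] -/
theorem List.map_finRange_eq_map_range {α : Type*} {n : ℕ} (f : Fin n → α) (g : ℕ → α) (h : ∀ i : Fin n, f i = g i.val) :
    (List.finRange n).map f = (List.range n).map g := by
  apply List.ext_getElem
  · simp
  · intro i h₁ h₂
    rw [List.getElem_map, List.getElem_map, List.getElem_finRange, List.getElem_range]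
    exact h _

/-- **`range (a b)` in `a` blocks of length `b`.** [folklore] -/
theorem List.map_range_mul {α : Type*} (a b : ℕ) (F : ℕ → α) :
    (List.range (a * b)).map F = ((List.range a).map fun x => (List.range b).map fun y => F (y + b * x)).flatten := by
  induction a with
  | zero => simp
  | succ a ih =>
    rw [Nat.succ_mul, List.range_add, List.map_append, ih, List.range_succ, List.map_append, List.flatten_append,
      List.map_singleton, List.flatten_singleton, List.map_map]
    congr 1
    refine List.map_congr_left fun y _ => ?_
    simp only [Function.comp_apply]
    rw [Nat.mul_comm, Nat.add_comm]

namespace BLC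

/-! ### Total accessors and the constraint table -/

/-- `src` as a total function on `ℕ` (junk `0` out of range). [folklore] -/
def srcN (I : BLC) (e : ℕ) : ℕ := if h : e < I.m then (I.src ⟨e, h⟩ : ℕ) else 0

/-- `dst` as a total function on `ℕ`. [folklore] -/
def dstN (I : BLC) (e : ℕ) : ℕ := if h : e < I.m then (I.dst ⟨e, h⟩ : ℕ) else 0

/-- `proj` as a total function on `ℕ × ℕ`. [folklore] -/
def projN (I : BLC) (e u : ℕ) : ℕ := if h : e < I.m ∧ u < I.WB then (I.proj ⟨e, h.1⟩ ⟨u, h.2⟩ : ℕ) else 0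

/-- The accessors on genuine indices. [folklore] -/
@[simp] theorem srcN_fin (I : BLC) (e : Fin I.m) : I.srcN e = I.src e := by simp [srcN]

/-- The accessors on genuine indices. [folklore] -/
@[simp] theorem dstN_fin (I : BLC) (e : Fin I.m) : I.dstN e = I.dst e := by simp [dstN]

/-- The accessors on genuine indices. [folklore] -/
@[simp] theorem projN_fin (I : BLC) (e : Fin I.m) (u : Fin I.WB) : I.projN e u = I.proj e u := by simp [projN]

/-- The projection row of an edge: `[proj e 0, …, proj e (WB-1)]`. [folklore] -/
def projRow (I : BLC) (e : ℕ) : List ℕ := (List.range I.WB).map (I.projN e)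

/-- **The constraint table** of an instance. [cite: AroraBarakCC2009, §1.3 (instances as lists)] -/
def conList (I : BLC) : List (ℕ × ℕ × List ℕ) := (List.range I.m).map fun e => (I.srcN e, I.dstN e, I.projRow e)

/-- The table has one row per edge. [folklore] -/
@[simp] theorem length_conList (I : BLC) : I.conList.length = I.m := by simp [conList]

/-- **The list rendering is the table with Alice's indices shifted by `nB`.** [folklore] -/
theorem toLC_constraints_conList (I : BLC) :
    I.toLC.constraints = I.conList.map fun t => (⟨t.1, I.nB + t.2.1, t.2.2⟩ : LabelCoverConstraint) := by
  rw [toLC_constraints, conList, List.map_map]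
  refine List.map_finRange_eq_map_range _ _ fun e => ?_
  simp only [Function.comp_apply, con, srcN_fin, dstN_fin, projRow, LabelCoverConstraint.mk.injEq, true_and]
  exact List.map_finRange_eq_map_range _ _ fun u => by simp

/-! ### Products -/

/-- **The product of two constraint tables** (sizes `nB₂, nA₂, WA₂` of the second factor). [cite: AroraBarakCC2009, §22.3.1 (φ^{*t})] -/
def prodL (nB₂ nA₂ WA₂ : ℕ) (L₁ L₂ : List (ℕ × ℕ × List ℕ)) : List (ℕ × ℕ × List ℕ) :=
  (L₁.map fun t₁ => L₂.map fun t₂ =>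
    (t₂.1 + nB₂ * t₁.1, t₂.2.1 + nA₂ * t₁.2.1, (t₁.2.2.map fun a₁ => t₂.2.2.map fun a₂ => a₂ + WA₂ * a₁).flatten)).flatten

/-- `src` of a product edge in mixed radix. [folklore] -/
theorem srcN_prod (I J : BLC) {e₁ e₂ : ℕ} (h₁ : e₁ < I.m) (h₂ : e₂ < J.m) :
    (I.prod J).srcN (e₂ + J.m * e₁) = J.srcN e₂ + J.nB * I.srcN e₁ := by
  have h : e₂ + J.m * e₁ < I.m * J.m := by
    calc e₂ + J.m * e₁ < J.m + J.m * e₁ := Nat.add_lt_add_right h₂ _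
      _ = J.m * (e₁ + 1) := by ring
      _ ≤ J.m * I.m := Nat.mul_le_mul_left _ h₁
      _ = I.m * J.m := Nat.mul_comm _ _
  have he : (finProdFinEquiv.symm (⟨e₂ + J.m * e₁, h⟩ : Fin (I.m * J.m))) = (⟨e₁, h₁⟩, ⟨e₂, h₂⟩) := by
    rw [Equiv.symm_apply_eq]; exact Fin.ext (by simp)
  rw [srcN, dif_pos h, srcN, dif_pos h₂, srcN, dif_pos h₁]
  simp only [prod, he, finProdFinEquiv_apply_val]

/-- `dst` of a product edge in mixed radix. [folklore] -/
theorem dstN_prod (I J : BLC) {e₁ e₂ : ℕ} (h₁ : e₁ < I.m) (h₂ : e₂ < J.m) :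
    (I.prod J).dstN (e₂ + J.m * e₁) = J.dstN e₂ + J.nA * I.dstN e₁ := by
  have h : e₂ + J.m * e₁ < I.m * J.m := by
    calc e₂ + J.m * e₁ < J.m + J.m * e₁ := Nat.add_lt_add_right h₂ _
      _ = J.m * (e₁ + 1) := by ring
      _ ≤ J.m * I.m := Nat.mul_le_mul_left _ h₁
      _ = I.m * J.m := Nat.mul_comm _ _
  have he : (finProdFinEquiv.symm (⟨e₂ + J.m * e₁, h⟩ : Fin (I.m * J.m))) = (⟨e₁, h₁⟩, ⟨e₂, h₂⟩) := by
    rw [Equiv.symm_apply_eq]; exact Fin.ext (by simp)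
  rw [dstN, dif_pos h, dstN, dif_pos h₂, dstN, dif_pos h₁]
  simp only [prod, he, finProdFinEquiv_apply_val]

/-- `proj` of a product edge in mixed radix. [folklore] -/
theorem projN_prod (I J : BLC) {e₁ e₂ u₁ u₂ : ℕ} (h₁ : e₁ < I.m) (h₂ : e₂ < J.m) (hu₁ : u₁ < I.WB) (hu₂ : u₂ < J.WB) :
    (I.prod J).projN (e₂ + J.m * e₁) (u₂ + J.WB * u₁) = J.projN e₂ u₂ + J.WA * I.projN e₁ u₁ := by
  have h : e₂ + J.m * e₁ < I.m * J.m := by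
    calc e₂ + J.m * e₁ < J.m + J.m * e₁ := Nat.add_lt_add_right h₂ _
      _ = J.m * (e₁ + 1) := by ring
      _ ≤ J.m * I.m := Nat.mul_le_mul_left _ h₁
      _ = I.m * J.m := Nat.mul_comm _ _
  have hu : u₂ + J.WB * u₁ < I.WB * J.WB := by
    calc u₂ + J.WB * u₁ < J.WB + J.WB * u₁ := Nat.add_lt_add_right hu₂ _
      _ = J.WB * (u₁ + 1) := by ring
      _ ≤ J.WB * I.WB := Nat.mul_le_mul_left _ hu₁
      _ = I.WB * J.WB := Nat.mul_comm _ _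
  have he : (finProdFinEquiv.symm (⟨e₂ + J.m * e₁, h⟩ : Fin (I.m * J.m))) = (⟨e₁, h₁⟩, ⟨e₂, h₂⟩) := by
    rw [Equiv.symm_apply_eq]; exact Fin.ext (by simp)
  have heu : (finProdFinEquiv.symm (⟨u₂ + J.WB * u₁, hu⟩ : Fin (I.WB * J.WB))) = (⟨u₁, hu₁⟩, ⟨u₂, hu₂⟩) := by
    rw [Equiv.symm_apply_eq]; exact Fin.ext (by simp)
  rw [projN, dif_pos ⟨h, hu⟩, projN, dif_pos ⟨h₂, hu₂⟩, projN, dif_pos ⟨h₁, hu₁⟩]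
  simp only [prod, he, heu, finProdFinEquiv_apply_val]

/-- The projection row of a product edge. [folklore] -/
theorem projRow_prod (I J : BLC) {e₁ e₂ : ℕ} (h₁ : e₁ < I.m) (h₂ : e₂ < J.m) :
    (I.prod J).projRow (e₂ + J.m * e₁) = ((I.projRow e₁).map fun a₁ => (J.projRow e₂).map fun a₂ => a₂ + J.WA * a₁).flatten := by
  unfold projRow
  rw [show (I.prod J).WB = I.WB * J.WB from rfl, List.map_range_mul, List.map_map]
  congr 1
  refine List.map_congr_left fun u₁ hu₁ => ?_
  simp only [Function.comp_apply, List.map_map]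
  refine List.map_congr_left fun u₂ hu₂ => ?_
  simp only [Function.comp_apply]
  exact projN_prod I J h₁ h₂ (List.mem_range.1 hu₁) (List.mem_range.1 hu₂)

/-- **The table of a product is the product of the tables.** [cite: AroraBarakCC2009, §22.3.1 (φ^{*t})] -/
theorem conList_prod (I J : BLC) : (I.prod J).conList = prodL J.nB J.nA J.WA I.conList J.conList := by
  unfold conList prodL
  rw [show (I.prod J).m = I.m * J.m from rfl, List.map_range_mul, List.map_map]
  congr 1
  refine List.map_congr_left fun e₁ he₁ => ?_
  simp only [Function.comp_apply, List.map_map]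
  refine List.map_congr_left fun e₂ he₂ => ?_
  have h₁ := List.mem_range.1 he₁
  have h₂ := List.mem_range.1 he₂
  simp only [Function.comp_apply, srcN_prod I J h₁ h₂, dstN_prod I J h₁ h₂, projRow_prod I J h₁ h₂]

/-! ### Blow-up -/

/-- **The table of the Alice-side blow-up**: every row `(s, d, p)` becomes the `c` rows `(s, j + c d, p)`. [folklore] -/
def blowAL (c : ℕ) (L : List (ℕ × ℕ × List ℕ)) : List (ℕ × ℕ × List ℕ) :=
  (L.map fun t => (List.range c).map fun j => (t.1, j + c * t.2.1, t.2.2)).flatten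

/-- **The table of a blow-up is the blow-up of the table.** [folklore] -/
theorem conList_blowA (I : BLC) (c : ℕ) (hc : 0 < c) : (I.blowA c hc).conList = blowAL c I.conList := by
  unfold conList blowAL
  rw [show (I.blowA c hc).m = I.m * c from rfl, List.map_range_mul, List.map_map]
  congr 1
  refine List.map_congr_left fun e he => ?_
  simp only [Function.comp_apply]
  refine List.map_congr_left fun j hj => ?_
  have h₁ := List.mem_range.1 he
  have h₂ := List.mem_range.1 hj
  have h : j + c * e < I.m * c := by
    calc j + c * e < c + c * e := Nat.add_lt_add_right h₂ _
      _ = c * (e + 1) := by ring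
      _ ≤ c * I.m := Nat.mul_le_mul_left _ h₁
      _ = I.m * c := Nat.mul_comm _ _
  have hfe : (finProdFinEquiv.symm (⟨j + c * e, h⟩ : Fin (I.m * c))) = (⟨e, h₁⟩, ⟨j, h₂⟩) := by
    rw [Equiv.symm_apply_eq]; exact Fin.ext (by simp)
  simp only [Prod.mk.injEq]
  refine ⟨?_, ?_, ?_⟩
  · rw [srcN, dif_pos h, srcN, dif_pos h₁]; simp only [blowA, hfe]
  · rw [dstN, dif_pos h, dstN, dif_pos h₁]; simp only [blowA, hfe, finProdFinEquiv_apply_val]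
  · unfold projRow
    rw [show (I.blowA c hc).WB = I.WB from rfl]
    refine List.map_congr_left fun u hu => ?_
    have hu' := List.mem_range.1 hu
    rw [projN, dif_pos ⟨h, hu'⟩, projN, dif_pos ⟨h₁, hu'⟩]
    simp only [blowA, hfe]

/-! ### The one-point instance and powers -/

/-- The table of the one-point instance. [folklore] -/
theorem conList_unit : unit.conList = [(0, 0, [0])] := by
  simp [conList, srcN, dstN, projRow, projN, unit]

/-- **The table of the `k`-fold product**, by iterating `prodL`. [cite: AroraBarakCC2009, §22.3.1 (φ^{*t})] -/
def npowL (I : BLC) : ℕ → List (ℕ × ℕ × List ℕ)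
  | 0 => [(0, 0, [0])]
  | k + 1 => prodL ((I.npow k).nB) ((I.npow k).nA) ((I.npow k).WA) I.conList (npowL I k)

/-- `npowL` computes the table of `npow`. [folklore] -/
theorem conList_npow (I : BLC) : ∀ k, (I.npow k).conList = I.npowL k
  | 0 => conList_unit
  | k + 1 => by rw [npow_succ, conList_prod, conList_npow I k]; rfl

end BLC

end Literature.Computability.Complexity
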